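import Literature.AnabelianGeometry.AbsoluteAnabelian.AbsTopIII.KummerTowerPadicSubfieldToolkitProofs
import Literature.NumberTheory.LFunctions.PadicRootsOfUnitySeparation
import Literature.NumberTheory.GaloisRepresentations.PadicCharacterNthRoot
import HarnessLib

/-!
# [AbsTopIII] Rmk. 1.5.3 (ii), CM-free witness — principal units and roots of unity of a
# finite-dimensional subfield of `ℚ̄_p`

Proof-only companion (no new definitions) of `AbsTopIII/KummerFaithful.lean` (abc-iut-L4-t1,
p404026); sequel of `KummerTowerPadicSubfieldToolkitProofs` (brick 2b of our witness for the named
fact `Rmk_1_5_3_ii`, S. Mochizuki, *Topics in Absolute Anabelian Geometry III*, §1, Rmk. 1.5.3 (ii),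
manuscript p. 33).  For a subfield `S ⊆ ℚ̄_p = PadicAlgCl p` of finite degree over `ℚ_p`:

* `exists_pow_norm_sub_one_lt` — **some fixed power of every unit of `S` is a principal unit**
  (pigeonhole modulo the maximal ideal, `exists_norm_sub_lt_one`);
* `norm_pow_prime_pow_sub_one_le` — the contraction `‖v^{p^k} − 1‖ ≤ ρ · max(‖p‖, ρ)^k` for a
  principal unit `v` with `‖v − 1‖ ≤ ρ ≤ 1` (`(1+y)^p − 1 = y (p + y w)`, the tree's
  `PadicRootsOfUnity.exists_one_add_pow_sub_one_eq`);
* `exists_torsion_bound` — **the roots of unity of `S` have bounded order**: there is `B ≥ 1` with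
  `ζ^B = 1` for every root of unity `ζ ∈ S` (a high `p`-power of a principal unit is within `‖p‖` of
  `1`, where no root of unity `≠ 1` lives: the tree's `PadicRootsOfUnity.norm_p_le_norm_sub_one`).

HONEST FRAMING: classical local arithmetic; OUR kernel proofs; nothing here bears on [IUTchIII]
Cor. 3.12. [cite: MochizukiAbsTopIII2015, Rmk 1.5.3 (ii) p.33]
-/

noncomputable section

open scoped Classical

namespace Literature.AnabelianGeometry.AbsoluteAnabelian.AbsTopIII

open Literature.NumberTheory.LFunctions Literature.NumberTheory

variable {p : ℕ} [Fact p.Prime] {S : IntermediateField ℚ_[p] (PadicAlgCl p)}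

/-! ## §4. Principal units -/

variable (p S) in
/-- **Some fixed power of every unit of `S` is a principal unit**: there is `M ≥ 1` with
`‖z^M − 1‖ < 1` for every `z ∈ S` of norm `1` (among `1, z, …, z^{p^d + 1}` two powers are congruent
modulo the maximal ideal, `exists_norm_sub_lt_one`; `M = (p^d + 1)!`).
[cite: MochizukiAbsTopIII2015, Rmk 1.5.3 (ii) p.33] -/
theorem exists_pow_norm_sub_one_lt [FiniteDimensional ℚ_[p] S] :
    ∃ M : ℕ, 0 < M ∧ ∀ z ∈ S, ‖z‖ = 1 → ‖z ^ M - 1‖ < 1 := by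
  set d := Module.finrank ℚ_[p] S with hd
  refine ⟨(p ^ d + 1).factorial, Nat.factorial_pos _, fun z hzS hz1 => ?_⟩
  -- pigeonhole among the powers `z^0, …, z^{p^d + 1}`
  have hx : ∀ i j : Fin 1, i ≠ j → ∀ m : ℤ,
      ‖(![(1 : PadicAlgCl p)]) i‖ ≠ ‖(![(1 : PadicAlgCl p)]) j‖ * (p : ℝ) ^ m := by
    intro i j hij
    exact absurd (Subsingleton.elim i j) hij
  obtain ⟨i, j, hij, hlt⟩ := exists_norm_sub_lt_one p S ![(1 : PadicAlgCl p)]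
    (fun i => by fin_cases i; exact one_mem S) (fun i => by fin_cases i; exact one_ne_zero) hx one_pos
    (N := p ^ d + 2) (fun i => z ^ (i : ℕ)) (fun i => pow_mem hzS _)
    (fun i => by rw [norm_pow, hz1, one_pow]) (by rw [Nat.div_one, ← hd]; omega)
  -- `‖z^m − 1‖ < 1` for `m = |i - j|`, `0 < m ≤ p^d + 1`
  have key : ∀ i j : Fin (p ^ d + 2), (i : ℕ) < j → ‖z ^ (i : ℕ) - z ^ (j : ℕ)‖ < 1 →
      ‖z ^ (p ^ d + 1).factorial - 1‖ < 1 := by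
    intro i j hlt' hn
    have hm : 0 < (j : ℕ) - i := Nat.sub_pos_of_lt hlt'
    have hmle : (j : ℕ) - i ≤ p ^ d + 1 := by
      have := j.isLt
      omega
    obtain ⟨c, hc⟩ := Nat.dvd_factorial hm hmle
    have hzm : ‖z ^ ((j : ℕ) - i) - 1‖ < 1 := by
      have hrew : z ^ (i : ℕ) - z ^ (j : ℕ) = -(z ^ (i : ℕ) * (z ^ ((j : ℕ) - i) - 1)) := by
        rw [mul_sub, mul_one, ← pow_add, Nat.add_sub_cancel' hlt'.le]
        ring
      rw [hrew, norm_neg, norm_mul, norm_pow, hz1, one_pow, one_mul] at hn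
      exact hn
    rw [hc, pow_mul]
    refine lt_of_le_of_lt (GaloisRepresentations.PadicAlgCl.norm_pow_sub_one_le ?_ c) hzm
    rw [norm_pow, hz1, one_pow]
  rcases lt_or_gt_of_ne (Fin.val_ne_of_ne hij) with h | h
  · exact key i j h hlt
  · exact key j i h (by rw [norm_sub_rev]; exact hlt)

/-- **Contraction of the `p`-th power map on principal units**: if `‖v − 1‖ ≤ ρ ≤ 1` then
`‖v^{p^k} − 1‖ ≤ ρ · max(‖p‖, ρ)^k` (from `(1+y)^p − 1 = y (p + y w)`, `‖w‖ ≤ 1`).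
[cite: MochizukiAbsTopIII2015, Rmk 1.5.3 (ii) p.33] -/
theorem norm_pow_prime_pow_sub_one_le {v : PadicAlgCl p} {ρ : ℝ} (hρ0 : 0 ≤ ρ) (hρ1 : ρ ≤ 1)
    (hv : ‖v - 1‖ ≤ ρ) (k : ℕ) :
    ‖v ^ p ^ k - 1‖ ≤ ρ * (max ‖(p : PadicAlgCl p)‖ ρ) ^ k := by
  have hc1 : max ‖(p : PadicAlgCl p)‖ ρ ≤ 1 :=
    max_le (PadicRootsOfUnity.norm_natCast_le_one p) hρ1
  induction k with
  | zero => simpa using hv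
  | succ k ih =>
    set r := ρ * (max ‖(p : PadicAlgCl p)‖ ρ) ^ k with hr
    have hr0 : 0 ≤ r := by positivity
    have hrρ : r ≤ ρ := by
      rw [hr]
      exact mul_le_of_le_one_right hρ0 (pow_le_one₀ (by positivity) hc1)
    have hr1 : r ≤ 1 := hrρ.trans hρ1
    set y := v ^ p ^ k - 1 with hy
    have hy1 : ‖y‖ ≤ 1 := ih.trans hr1
    obtain ⟨w, hw, hid⟩ := PadicRootsOfUnity.exists_one_add_pow_sub_one_eq hy1 p
    have hv' : v ^ p ^ (k + 1) - 1 = y * ((p : PadicAlgCl p) + y * w) := by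
      rw [← hid, hy, add_sub_cancel, ← pow_mul, ← pow_succ]
    rw [hv', norm_mul, pow_succ, ← mul_assoc]
    refine mul_le_mul ih ?_ (norm_nonneg _) hr0
    refine (IsUltrametricDist.norm_add_le_max _ _).trans (max_le_max le_rfl ?_)
    rw [norm_mul]
    calc ‖y‖ * ‖w‖ ≤ r * 1 := mul_le_mul ih hw (norm_nonneg _) hr0
      _ ≤ ρ := by rw [mul_one]; exact hrρ

/-! ## §5. Roots of unity of a finite-dimensional subfield have bounded order -/

variable (p S) in
/-- **The roots of unity of `S` have bounded order**: there is `B ≥ 1` with `ζ^B = 1` for every root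
of unity `ζ ∈ S`.  Proof: `ζ^M` is a principal unit (`exists_pow_norm_sub_one_lt`), principal units
of `S` satisfy `‖u − 1‖ ≤ ρ₀ < 1` uniformly (discreteness, `norm_pow_le_inv_of_norm_lt_one`), so a
fixed `p`-power of `ζ^M` is a root of unity within `‖p‖` of `1` (`norm_pow_prime_pow_sub_one_le`),
hence equal to `1` (`PadicRootsOfUnity.norm_p_le_norm_sub_one`).
[cite: MochizukiAbsTopIII2015, Rmk 1.5.3 (ii) p.33] -/
theorem exists_torsion_bound [FiniteDimensional ℚ_[p] S] :
    ∃ B : ℕ, 0 < B ∧ ∀ ζ ∈ S, ∀ N : ℕ, 0 < N → ζ ^ N = 1 → ζ ^ B = 1 := by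
  have hp1 : (1 : ℝ) < p := by exact_mod_cast (Fact.out : p.Prime).one_lt
  have hp0 : (0 : ℝ) < p := by positivity
  obtain ⟨d, hd, hdisc⟩ := exists_norm_pow_eq_zpow p S
  obtain ⟨M, hM, hMU⟩ := exists_pow_norm_sub_one_lt p S
  -- the uniform bound `ρ₀ = p^{-1/d}` on `‖u − 1‖` for principal units `u ∈ S`
  set ρ₀ : ℝ := ((p : ℝ)⁻¹) ^ ((d : ℝ)⁻¹) with hρ₀
  have hρ₀pos : 0 < ρ₀ := Real.rpow_pos_of_pos (inv_pos.mpr hp0) _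
  have hρ₀lt : ρ₀ < 1 :=
    Real.rpow_lt_one (inv_pos.mpr hp0).le (inv_lt_one_of_one_lt₀ hp1) (by positivity)
  have hρ₀le : ρ₀ ≤ 1 := hρ₀lt.le
  have hunif : ∀ u ∈ S, ‖u - 1‖ < 1 → ‖u - 1‖ ≤ ρ₀ := by
    intro u hu hlt
    have h1 : ‖u - 1‖ ^ d ≤ (p : ℝ)⁻¹ := norm_pow_le_inv_of_norm_lt_one hd hdisc (sub_mem hu (one_mem S)) hlt
    have h2 : (‖u - 1‖ ^ d) ^ ((d : ℝ)⁻¹) ≤ ((p : ℝ)⁻¹) ^ ((d : ℝ)⁻¹) :=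
      Real.rpow_le_rpow (by positivity) h1 (by positivity)
    rwa [Real.pow_rpow_inv_natCast (norm_nonneg _) hd.ne'] at h2
  -- the contraction factor
  set c : ℝ := max ‖(p : PadicAlgCl p)‖ ρ₀ with hc
  have hc0 : 0 < c := lt_max_of_lt_right hρ₀pos
  have hc1 : c < 1 := max_lt (by
    rw [show ‖(p : PadicAlgCl p)‖ = (p : ℝ)⁻¹ from by
      rw [← map_natCast (algebraMap ℚ_[p] (PadicAlgCl p)) p]
      exact (PadicAlgCl.norm_extends (p := p) (p : ℚ_[p])).trans Padic.norm_p]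
    exact inv_lt_one_of_one_lt₀ hp1) hρ₀lt
  obtain ⟨j₀, hj₀⟩ := exists_pow_lt_of_lt_one (PadicRootsOfUnity.norm_p_pos (p := p)) hc1
  refine ⟨M * p ^ j₀, Nat.mul_pos hM (pow_pos (Fact.out : p.Prime).pos _), fun ζ hζ N hN hζN => ?_⟩
  have hζ1 : ‖ζ‖ = 1 := PadicRootsOfUnity.norm_eq_one_of_pow_eq_one hN hζN
  -- `θ = ζ^M` is a principal unit, `η = θ^{p^{j₀}}` is a root of unity within `‖p‖` of `1`
  set θ := ζ ^ M with hθ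
  have hθU : ‖θ - 1‖ ≤ ρ₀ := hunif θ (pow_mem hζ M) (hMU ζ hζ hζ1)
  have hη : ‖θ ^ p ^ j₀ - 1‖ < ‖(p : PadicAlgCl p)‖ :=
    lt_of_le_of_lt (norm_pow_prime_pow_sub_one_le hρ₀pos.le hρ₀le hθU j₀)
      (lt_of_le_of_lt (mul_le_of_le_one_left (pow_nonneg hc0.le _) hρ₀le) hj₀)
  have hηN : (θ ^ p ^ j₀) ^ N = 1 := by
    rw [hθ, ← pow_mul, ← pow_mul, show M * (p ^ j₀ * N) = N * (M * p ^ j₀) by ring, pow_mul, hζN,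
      one_pow]
  have hη1 : θ ^ p ^ j₀ = 1 := by
    by_contra hne
    exact absurd (PadicRootsOfUnity.norm_p_le_norm_sub_one hN hηN hne) (not_le.mpr hη)
  rw [pow_mul, ← hθ, hη1]

end Literature.AnabelianGeometry.AbsoluteAnabelian.AbsTopIII

end
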